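import Literature.Geometry.Riemannian.SurgicalRicciFlowProofs
import Literature.Geometry.Riemannian.HamiltonPICHolds
import Literature.Geometry.Riemannian.RicciFlowMaximalExistence
import Literature.Geometry.Riemannian.RicciFlowSingularTimeHolds
import Literature.Geometry.Riemannian.RicciFlowScalarCurvatureHolds
import HarnessLib

/-!
# Chen–Zhu's Theorem 1.1, as rendered by `ChenZhuResolvableIn`, follows from Hamilton's
# classification and short-time existence
(topic `Geometry/Riemannian`)

`SurgicalRicciFlow.lean` renders the structure asserted by **Chen–Zhu 2006, Thm. 1.1**
(J. Differential Geom. 74 (2006); arXiv:math/0504478, p. 3) — a compact simply connected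
4-manifold `M` with a metric `g₀` of positive isotropic curvature is resolved by a Ricci flow with
finitely many surgeries — as `∃ m, ChenZhuResolvableIn m M g₀`, and the tree PROVES that this
structure statement together with Cerf's `Γ₄ = 0` implies Hamilton's classification
(`hamilton_chen_tang_zhu_of_chenZhu_of_cerf`, `SurgicalRicciFlowBridge.lean`; Hamilton 1997,
Cor. 1.2(a): such an `M` is diffeomorphic to `S⁴`).

This file records the **converse**, which is the finding of the review of that decomposition
(D-0026/D-0027): the rendered structure statement follows from the classification
`hamilton_chen_tang_zhu` (equivalently `hamilton_pic_classification_four`) and short-time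
existence of the Ricci flow (`ricciFlow_shortTime_existence`, Hamilton 1982, Thm. 4.2) — with
`m = 0` surgeries. Indeed the base case `ChenZhuResolvableIn 0 M g₀` asks for a maximal Ricci
flow of Riemannian metrics from `g₀` on a finite interval `[0, T)` (it exists: short-time
existence gives the maximal solution, `ricciFlow_maximal_existence_of_shortTime_existence`, and
the all-time alternative is excluded for PIC data by the proved bound `T ≤ 2/R_min(0)`,
`ricciFlow_singularTime_le_holds` with
`exists_pos_le_scalarCurvature_of_hasPositiveIsotropicCurvature_holds`) and for the purely
topological clause (iv) `IsUnionOfPieces M`, which for a connected `M` is membership in the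
closure of Hamilton's pieces under connected sums (`IsUnionOfPieces.of_isConnectedSumOf`), i.e.
exactly the conclusion of the classification. Consequently, in this tree,

  `(∀ M g₀ PIC simply connected, ∃ m, ChenZhuResolvableIn m M g₀)` and `hamilton_chen_tang_zhu`

are equivalent modulo the two named facts `ricciFlow_shortTime_existence` and
`cerf_pi0DiffDisc_relBoundary_three` (`chenZhuResolvable_iff_hamilton_chen_tang_zhu`): the
structure statement, as rendered, carries no proof burden beyond the classification it was cut
from, and a discharge of either is a formal proof of the Ricci flow with surgery (Chen–Zhu 2006,
§§2–5 on Perelman's techniques). This is why the structure statement is not kept as a separate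
named fact of the tree (it is the explicit hypothesis of the bridge theorems and the conclusion of
the analytic discharge path `chenZhu_ricciFlowWithSurgery_of_step`, `SurgicalSolutionsCount.lean`).
Nothing here uses the surgery clauses (i)–(iii): the printed Thm. 1.1 is of course NOT a
consequence of its Cor. 1.2 — the rendering `ChenZhuResolvableIn` does not record that the last
stage becomes *extinct* (Chen–Zhu 2006, §5, p. 27: "`Ω_σ` is empty … the solution becomes
extinct"), only that it is maximal and that `M_m` has the topology (iv).

## Main results

* `exists_isMaximalRicciFlow_of_shortTime_existence` — from short-time existence, every PIC
  metric on a nonempty closed 4-manifold has a maximal Ricci flow on a finite `[0, T)`.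
* `chenZhuResolvableIn_zero_of_isConnectedSumOf` — a maximal flow on a connected member of
  Hamilton's class is a resolution with `0` surgeries.
* `chenZhuResolvable_of_classification`, `chenZhuResolvable_of_hamilton_chen_tang_zhu` — the
  rendered Thm. 1.1 from the classification and short-time existence.
* `chenZhuResolvable_iff_hamilton_chen_tang_zhu` — equivalence modulo short-time existence and
  Cerf's theorem.

## References

* B.-L. Chen, X.-P. Zhu, *Ricci flow with surgery on four-manifolds with positive isotropic
  curvature*, J. Differential Geom. 74 (2006) 177–264, arXiv:math/0504478: Thm. 1.1 and Cor. 1.2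
  (p. 3), §5 p. 27. [ChenZhu2006]
* R. S. Hamilton, *Four-manifolds with positive isotropic curvature*, Comm. Anal. Geom. 5 (1997)
  1–92, Thm. 1.1 (p. 2), Cor. 1.2(a) (p. 3). [Hamilton1997]
* R. S. Hamilton, *Three-manifolds with positive Ricci curvature*, J. Differential Geom. 17
  (1982), Thm. 4.2, Thm. 14.1. [Hamilton1982]
-/

noncomputable section

open Set Function TopologicalSpace
open scoped Manifold ContDiff Topology

namespace Literature.Geometry.Riemannian

open Lorentzian Literature.Topology.FourManifolds

/-- **The maximal solution from PIC data, from short-time existence.** Given short-time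
existence of the Ricci flow (`ricciFlow_shortTime_existence`), every `C^∞` Riemannian metric of
positive isotropic curvature on a nonempty closed smooth 4-manifold is the initial value of a
maximal Ricci flow of Riemannian metrics on a finite interval `[0, T)`: the maximal solution
exists (`ricciFlow_maximal_existence_of_shortTime_existence`, Zorn), and a solution for all
`t ≥ 0` is impossible since `T' ≤ 2/α` for every `T'` once `R(g₀) ≥ α > 0`
(`ricciFlow_singularTime_le_holds`, `exists_pos_le_scalarCurvature_of_hasPositiveIsotropicCurvature_holds`;
Chen–Zhu 2006, §4, p. 19: "the maximal time `T` must be finite").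
[cite: ChenZhu2006, §4, p. 19] [cite: Hamilton1982, §14, Thm. 14.1 (p. 296)] -/
theorem exists_isMaximalRicciFlow_of_shortTime_existence
    (hST : ricciFlow_shortTime_existence.{0, 0, 0})
    (M : Type) [TopologicalSpace M] [T2Space M] [SecondCountableTopology M] [CompactSpace M]
    [Nonempty M] [ChartedSpace (EuclideanSpace ℝ (Fin 4)) M] [IsManifold (𝓡 4) ∞ M]
    (g₀ : PseudoRiemannianMetric (𝓡 4) ∞ (EuclideanSpace ℝ (Fin 4))
      (TangentSpace (𝓡 4) : M → Type _))
    (hg₀ : g₀.IsRiemannian) (hpic : g₀.HasPositiveIsotropicCurvature) :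
    ∃ (T : ℝ) (g : ℝ → PseudoRiemannianMetric (𝓡 4) ∞ (EuclideanSpace ℝ (Fin 4))
        (TangentSpace (𝓡 4) : M → Type _))
      (cov : ℝ → CovariantDerivative (𝓡 4) (EuclideanSpace ℝ (Fin 4))
        (TangentSpace (𝓡 4) : M → Type _)),
      IsMaximalRicciFlow g cov T ∧ g 0 = g₀ := by
  rcases ricciFlow_maximal_existence_of_shortTime_existence hST (𝓡 4) M g₀ hg₀ with
    ⟨g, cov, hflow, hR, h0⟩ | ⟨T, -, g, cov, hmax, h0⟩
  · -- an all-time flow from PIC data is impossible: `T' ≤ 2/α₀` for every `T'`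
    exfalso
    have h0' : (g 0).HasPositiveIsotropicCurvature := h0 ▸ hpic
    have hLC : (g 0).IsLeviCivita (cov 0) := hflow.isLeviCivita 0 (by simp)
    obtain ⟨α₀, hα₀, hα₀R⟩ :=
      exists_pos_le_scalarCurvature_of_hasPositiveIsotropicCurvature_holds M (g 0) (cov 0)
        (hR 0 (by simp)) hLC (h0' (cov 0) hLC)
    have key : ∀ T' : ℝ, 0 < T' → T' ≤ 2 / α₀ := by
      intro T' hT'
      have := ricciFlow_singularTime_le_holds (𝓡 4) M T' hT' g cov
        (hflow.mono Ico_subset_Ici_self) (fun t ht ↦ hR t ht.1) α₀ hα₀ hα₀R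
      have hrank : (Module.finrank ℝ (EuclideanSpace ℝ (Fin 4)) : ℝ) = 4 := by simp
      rw [hrank] at this
      calc T' ≤ 4 / (2 * α₀) := this
        _ = 2 / α₀ := by field_simp; norm_num
    have := key (2 / α₀ + 1) (by positivity)
    linarith
  · exact ⟨T, g, cov, hmax, h0⟩

/-- **A resolution with no surgery, from topology.** On a connected closed 4-manifold lying in
the closure of Hamilton's pieces under connected sums, every maximal Ricci flow `g` on `[0, T)`
witnesses `ChenZhuResolvableIn 0 M (g 0)`: clause (iv) of the rendering, `IsUnionOfPieces M`, is
a property of the manifold alone (`IsUnionOfPieces.of_isConnectedSumOf`,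
`SurgicalRicciFlowProofs.lean`). [cite: ChenZhu2006, Thm. 1.1 (iv) (p. 3)] -/
theorem chenZhuResolvableIn_zero_of_isConnectedSumOf
    {M : Type} [TopologicalSpace M] [T2Space M] [SecondCountableTopology M] [CompactSpace M]
    [ChartedSpace (EuclideanSpace ℝ (Fin 4)) M] [IsManifold (𝓡 4) ∞ M] [ConnectedSpace M]
    (htop : IsConnectedSumOf 4 IsHamiltonPICPiece M)
    {g : ℝ → PseudoRiemannianMetric (𝓡 4) ∞ (EuclideanSpace ℝ (Fin 4))
      (TangentSpace (𝓡 4) : M → Type _)}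
    {cov : ℝ → CovariantDerivative (𝓡 4) (EuclideanSpace ℝ (Fin 4))
      (TangentSpace (𝓡 4) : M → Type _)}
    {T : ℝ} (hmax : IsMaximalRicciFlow g cov T) : ChenZhuResolvableIn 0 M (g 0) :=
  (chenZhuResolvableIn_zero_iff (g 0)).2 ⟨g, cov, T, hmax, rfl, IsUnionOfPieces.of_isConnectedSumOf htop⟩

/-- **Chen–Zhu's Thm. 1.1 (rendered) from Hamilton's Thm. 1.1 (printed pieces) and short-time
existence.** If every closed simply connected PIC 4-manifold lies in the closure of Hamilton's
pieces under connected sums (`hamilton_pic_classification_four`) and the Ricci flow has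
short-time solutions (`ricciFlow_shortTime_existence`), then every such `(M, g₀)` is resolved in
the sense of `ChenZhuResolvableIn` — by its maximal flow and `0` surgeries.
[cite: ChenZhu2006, Thm. 1.1 and Cor. 1.2 (p. 3)] [cite: Hamilton1997, Thm. 1.1 (p. 2)] -/
theorem chenZhuResolvable_of_classification
    (h : hamilton_pic_classification_four) (hST : ricciFlow_shortTime_existence.{0, 0, 0}) :
    ∀ (M : Type) [TopologicalSpace M] [T2Space M] [SecondCountableTopology M] [CompactSpace M]
      [ChartedSpace (EuclideanSpace ℝ (Fin 4)) M] [IsManifold (𝓡 4) ∞ M] [SimplyConnectedSpace M]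
      (g₀ : PseudoRiemannianMetric (𝓡 4) ∞ (EuclideanSpace ℝ (Fin 4))
        (TangentSpace (𝓡 4) : M → Type _)),
      g₀.IsRiemannian → g₀.HasPositiveIsotropicCurvature → ∃ m : ℕ, ChenZhuResolvableIn m M g₀ := by
  intro M _ _ _ _ _ _ _ g₀ hg₀ hpic
  obtain ⟨T, g, cov, hmax, h0⟩ :=
    exists_isMaximalRicciFlow_of_shortTime_existence hST M g₀ hg₀ hpic
  subst h0
  exact ⟨0, chenZhuResolvableIn_zero_of_isConnectedSumOf (h M ⟨g 0, hg₀, hpic⟩) hmax⟩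

/-- **Chen–Zhu's Thm. 1.1 (rendered) from Hamilton's Cor. 1.2(a) (`hamilton_chen_tang_zhu`) and
short-time existence**: Cor. 1.2(a) is equivalent to Thm. 1.1 with the printed pieces in the
simply connected case (`hamilton_pic_sphere_four_iff_classification`,
`hamilton_pic_sphere_four_of_hamilton_chen_tang_zhu`).
[cite: ChenZhu2006, Thm. 1.1 and Cor. 1.2 (p. 3)] [cite: Hamilton1997, Cor. 1.2(a) (p. 3)] -/
theorem chenZhuResolvable_of_hamilton_chen_tang_zhu
    (h : hamilton_chen_tang_zhu) (hST : ricciFlow_shortTime_existence.{0, 0, 0}) :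
    ∀ (M : Type) [TopologicalSpace M] [T2Space M] [SecondCountableTopology M] [CompactSpace M]
      [ChartedSpace (EuclideanSpace ℝ (Fin 4)) M] [IsManifold (𝓡 4) ∞ M] [SimplyConnectedSpace M]
      (g₀ : PseudoRiemannianMetric (𝓡 4) ∞ (EuclideanSpace ℝ (Fin 4))
        (TangentSpace (𝓡 4) : M → Type _)),
      g₀.IsRiemannian → g₀.HasPositiveIsotropicCurvature → ∃ m : ℕ, ChenZhuResolvableIn m M g₀ :=
  chenZhuResolvable_of_classification
    (hamilton_pic_sphere_four_iff_classification.1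
      (hamilton_pic_sphere_four_of_hamilton_chen_tang_zhu h)) hST

/-- **The rendered Thm. 1.1 and Cor. 1.2(a) are one debt.** Modulo short-time existence of the
Ricci flow (`ricciFlow_shortTime_existence`) and Cerf's `π₀ Diff(D³ rel ∂) = 0`
(`cerf_pi0DiffDisc_relBoundary_three`), the structure statement
`∀ M g₀, … → ∃ m, ChenZhuResolvableIn m M g₀` and Hamilton's Cor. 1.2(a)
(`hamilton_chen_tang_zhu`) are equivalent: `→` is the tree's reconstruction of the manifold
from the pieces (`hamilton_chen_tang_zhu_of_chenZhu_of_cerfRelBoundary`, `HamiltonPICHolds.lean`),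
`←` is `chenZhuResolvable_of_hamilton_chen_tang_zhu`.
[cite: ChenZhu2006, Thm. 1.1 and Cor. 1.2 (p. 3)] [cite: Hamilton1997, Cor. 1.2(a) (p. 3)] -/
theorem chenZhuResolvable_iff_hamilton_chen_tang_zhu
    (hST : ricciFlow_shortTime_existence.{0, 0, 0}) (hcerf : cerf_pi0DiffDisc_relBoundary_three) :
    (∀ (M : Type) [TopologicalSpace M] [T2Space M] [SecondCountableTopology M] [CompactSpace M]
      [ChartedSpace (EuclideanSpace ℝ (Fin 4)) M] [IsManifold (𝓡 4) ∞ M] [SimplyConnectedSpace M]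
      (g₀ : PseudoRiemannianMetric (𝓡 4) ∞ (EuclideanSpace ℝ (Fin 4))
        (TangentSpace (𝓡 4) : M → Type _)),
      g₀.IsRiemannian → g₀.HasPositiveIsotropicCurvature → ∃ m : ℕ, ChenZhuResolvableIn m M g₀) ↔
      hamilton_chen_tang_zhu :=
  ⟨fun h ↦ hamilton_chen_tang_zhu_of_chenZhu_of_cerfRelBoundary h hcerf,
    fun h ↦ chenZhuResolvable_of_hamilton_chen_tang_zhu h hST⟩

end Literature.Geometry.Riemannian

end
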